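import Mathlib
import Literature.NumberTheory.LFunctions.Zhang2022.ToolkitSmoothEulerMajorant
import Literature.NumberTheory.LFunctions.Zhang2022.TypedSection16B
import Literature.NumberTheory.LFunctions.Zhang2022.Section16Eval1617
import HarnessLib

/-!
# Zhang (2022) §16 (16.15): the summed majorant `Σ_{n₁∈𝒩(𝔮),n₁<T}|ϖ₂ⱼ(n₁)|τ₃(n₁)/n₁ ≪ 𝓛⁶`
# (`Typed.Section16B.Inline16_varpi2WeightSum`) FROM a local multiplicative majorant of `ϖ₂ⱼ`

Topic `Literature/NumberTheory/LFunctions/Zhang2022` (Landau–Siegel audit tree; verdict-neutral).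
Y. Zhang, *Discrete mean estimates and the Landau–Siegel zero*, arXiv:2211.02515v1 (2022)
[Zhang2022LandauSiegel] — **an unrefereed manuscript under adjudication**; nothing here bears on its
Theorems 1–2. ZHANG-L discharge lane (WP16, seat zl-w16-p4, helper of zl-w16-p8; GAP row G-L4t5-1).

The node `Inline16_varpi2WeightSum c′` (TypedSection16B, NOT PRINTED: the input that the printed
`O(1/𝓛)` of (16.15) presupposes once u037 is read with its `τ₃(n₁)𝓛⁻⁷` error) asserts
`Σ_{n₁∈𝒩(𝔮), n₁<T} |ϖ₂ⱼ(n₁)|τ₃(n₁)/n₁ ≤ C𝓛⁶`. The exponent `6` is SHARP: it is the order of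
`∏_{q<D⁴}(1 + 6/q)`, i.e. it requires the multiplicative majorant of `|ϖ₂ⱼ|τ₃` to take the value
`6 + O(1/q) + O(α𝓛·log q)` at the primes (`|ϖ₂ⱼ(q)| → 2`, `τ₃(q) = 3`) — the LOCAL structure of
`ϖ₂ⱼ(n) = Σ_{dl=n}λ₂(d)d^{β_j}χ(l)𝓜₂(d,l;1−β_j)/𝓜₂*(1−β_j)` (§16 p. 93; App. A p. 105–106: the ratio
`𝓜₂(d,l;s)/𝓜₂*(s)` is a product of local factors tending to `Π₂`-type values `(1 − χ(q)/(q−1))⁻¹`).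
This file proves the SUMMATION half as a kernel edge (theorems only; no definitions, no named facts):

* `inline16_varpi2WeightSum_of_localMajorant` — IF, for all large `D` under (A), `j = 1, 2` and every
  `n₁ ∈ 𝒩(𝔮)`, `n₁ < T`,
  `|ϖ₂ⱼ(n₁)|τ₃(n₁) ≤ K₀·∏_{q^r ∥ n₁} a(q,r)` with `a(q,1) = 6 + C₀(q⁻¹ + α𝓛·log q)` and
  `a(q,r) = C₀(3/2)^r` (`r ≥ 2`) (hypothesis spelled inline — the pointwise local majorant, to be supplied
  from the local structure of `ϖ₂ⱼ`), THEN `Inline16_varpi2WeightSum c′`, with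
  `C = K₀·e^{24+21C₀}·4⁶`: by the tree's smooth-number Euler-product majorant
  `SmoothEulerMajorant.sum_smooth_multMajorant_div_le_prod` (`𝒩(𝔮)` = the `D⁴`-smooth numbers,
  `mem_nset_frakq_iff`), the local Euler sums `Σ_{r≥1}a(q,r)/q^r ≤ 6/q + 10C₀/q² + C₀α𝓛·(log q)/q`,
  and `∏_{q<D⁴}(1 + e(q)) ≤ e^{4·6 + G}(log D⁴)^6` (`prod_primesBelow_one_add_le_of_sum_le`, from
  `1 + x ≤ eˣ` and the elementary Mertens bounds `MertensBound.sum_inv_prime_le` /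
  `sum_log_div_prime_le`; `G = 20C₀ + C₀α𝓛(4𝓛 + log 4) ≤ 21C₀` for large `D`).

## References

* Y. Zhang, arXiv:2211.02515v1 (2022), §16 (16.15) p. 94, tex L4634–L4637; §16 p. 93 (u030);
  App. A pp. 105–106. [cite: Zhang2022LandauSiegel, §16 (16.15) p.94]
* G. H. Hardy, E. M. Wright, *An Introduction to the Theory of Numbers*, 6th ed., Thms 425, 427.
  [cite: HardyWright2008, Thm 427]
-/

noncomputable section

open Real Finset
open Literature.NumberTheory.LFunctions.Zhang2022
open Literature.NumberTheory.LFunctions.Zhang2022.Skeleton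
open Literature.NumberTheory.LFunctions.Zhang2022.Typed.Section16A
open Literature.NumberTheory.LFunctions.Zhang2022.SmoothEulerMajorant

namespace Literature.NumberTheory.LFunctions.Zhang2022.Typed.Section16B

/-! ## Euler products with local terms `≤ k/q + g(q)` -/

/-- `Σ_{q<y, q prime} (log q)/q ≤ log y + log 4` (the tree's elementary Mertens-1 bound
`MertensBound.sum_log_div_prime_le` over `p ≤ y`). [cite: HardyWright2008, Thm 425] -/
theorem sum_primesBelow_log_div_le (y : ℕ) :
    ∑ q ∈ y.primesBelow, Real.log q / q ≤ Real.log y + Real.log 4 := by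
  have hsub : y.primesBelow ⊆ Nat.primesLE y := by
    intro q hq
    rw [Nat.mem_primesBelow] at hq
    exact Nat.mem_primesLE.mpr ⟨hq.1.le, hq.2⟩
  refine (Finset.sum_le_sum_of_subset_of_nonneg hsub fun q hq _ => ?_).trans
    (MertensBound.sum_log_div_prime_le y)
  have hq1 : (1 : ℝ) ≤ q := by exact_mod_cast (Nat.mem_primesLE.mp hq).2.one_lt.le
  exact div_nonneg (Real.log_nonneg hq1) (by linarith)

/-- **Euler products with local terms `≤ k/q + g(q)`**: for `y ≥ 2`, `k ∈ ℕ` and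
`0 ≤ e(q) ≤ k/q + g(q)` at the primes `q < y` with `Σ_{q<y} g(q) ≤ G`,
`∏_{q<y}(1 + e(q)) ≤ e^{4k+G}(log y)^k` (`1 + x ≤ eˣ`, `Σ_{q≤y}1/q ≤ log log y + 4`).
[cite: HardyWright2008, Thm 427] -/
theorem prod_primesBelow_one_add_le_of_sum_le {y : ℕ} (hy : 2 ≤ y) (k : ℕ) {G : ℝ}
    {e g : ℕ → ℝ} (he0 : ∀ q ∈ y.primesBelow, 0 ≤ e q)
    (he : ∀ q ∈ y.primesBelow, e q ≤ (k : ℝ) / q + g q) (hG : ∑ q ∈ y.primesBelow, g q ≤ G) :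
    ∏ q ∈ y.primesBelow, (1 + e q) ≤ Real.exp (4 * k + G) * Real.log y ^ k := by
  have h1 : ∏ q ∈ y.primesBelow, (1 + e q) ≤ Real.exp (∑ q ∈ y.primesBelow, e q) := by
    rw [Real.exp_sum]
    exact Finset.prod_le_prod (fun q hq => by linarith [he0 q hq]) fun q _ => by
      linarith [Real.add_one_le_exp (e q)]
  have h2 : ∑ q ∈ y.primesBelow, e q ≤ (k : ℝ) * (Real.log (Real.log y) + 4) + G := by
    calc ∑ q ∈ y.primesBelow, e q ≤ ∑ q ∈ y.primesBelow, ((k : ℝ) / q + g q) := Finset.sum_le_sum he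
      _ = (k : ℝ) * ∑ q ∈ y.primesBelow, (1 : ℝ) / q + ∑ q ∈ y.primesBelow, g q := by
          rw [Finset.sum_add_distrib, Finset.mul_sum]
          congr 1
          exact Finset.sum_congr rfl fun q _ => by ring
      _ ≤ (k : ℝ) * (Real.log (Real.log y) + 4) + G := by
          gcongr
          exact sum_primesBelow_inv_le hy
  -- `exp(k log log y) ≤ (log y)^k` also when `log y ≤ … `: for `y ≥ 2`, `log y > 0`
  have hlogy : 0 < Real.log y := Real.log_pos (by exact_mod_cast (show 1 < y by omega))
  calc ∏ q ∈ y.primesBelow, (1 + e q) ≤ Real.exp (∑ q ∈ y.primesBelow, e q) := h1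
    _ ≤ Real.exp ((k : ℝ) * (Real.log (Real.log y) + 4) + G) := Real.exp_le_exp.mpr h2
    _ = Real.exp (4 * k + G) * Real.log y ^ k := by
        rw [show (k : ℝ) * (Real.log (Real.log y) + 4) + G =
          (4 * k + G) + (k : ℝ) * Real.log (Real.log y) by ring, Real.exp_add,
          Real.exp_nat_mul, Real.exp_log hlogy]

/-! ## The local weights and their Euler sums -/

/-- The geometric tail: for `q ≥ 2`, `Σ_{r≥0} (3/(2q))^{r+2} ≤ 9/q²`
(`(3/(2q))²/(1 − 3/(2q)) ≤ (9/(4q²))·4`). [folklore] -/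
private theorem tsum_geometric_tail_le {q : ℕ} (hq : 2 ≤ q) :
    Summable (fun r : ℕ => (3 / (2 * (q : ℝ))) ^ (r + 2)) ∧
      ∑' r : ℕ, (3 / (2 * (q : ℝ))) ^ (r + 2) ≤ 9 / (q : ℝ) ^ 2 := by
  have hq0 : (0 : ℝ) < q := by exact_mod_cast (show 0 < q by omega)
  have hq2 : (2 : ℝ) ≤ q := by exact_mod_cast hq
  set x : ℝ := 3 / (2 * (q : ℝ)) with hx
  have hx0 : 0 ≤ x := by rw [hx]; positivity
  have hx34 : x ≤ 3 / 4 := by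
    rw [hx, div_le_div_iff₀ (by positivity) (by norm_num)]; nlinarith
  have hx1 : x < 1 := by linarith
  have hgeom : HasSum (fun r : ℕ => x ^ r) (1 - x)⁻¹ := hasSum_geometric_of_lt_one hx0 hx1
  have hs : Summable (fun r : ℕ => x ^ (r + 2)) := by
    simp_rw [pow_add]
    exact hgeom.summable.mul_right _
  refine ⟨hs, ?_⟩
  calc ∑' r : ℕ, x ^ (r + 2) = (∑' r : ℕ, x ^ r) * x ^ 2 := by
        simp_rw [pow_add]; rw [tsum_mul_right]
    _ = (1 - x)⁻¹ * x ^ 2 := by rw [hgeom.tsum_eq]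
    _ ≤ 4 * (3 / (2 * (q : ℝ))) ^ 2 := by
        rw [← hx]
        have h14 : (1 - x)⁻¹ ≤ 4 := by
          rw [inv_le_comm₀ (by linarith) (by norm_num)]; linarith
        exact mul_le_mul_of_nonneg_right h14 (sq_nonneg x)
    _ = 9 / (q : ℝ) ^ 2 := by field_simp; ring

/-- The local Euler sum of the weights `a(q,1) = A₁`, `a(q,r) = C₀(3/2)^r` (`r ≥ 2`), `q ≥ 2`, `C₀ ≥ 0`:
`Σ_{r≥0} a(q,r+1)/q^{r+1}` converges and is `≤ A₁/q + 9C₀/q²`. [folklore] -/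
private theorem local_euler_sum_le {q : ℕ} (hq : 2 ≤ q) {A₁ C₀ : ℝ} (hC₀ : 0 ≤ C₀) :
    Summable (fun r : ℕ =>
        (if r + 1 = 1 then A₁ else C₀ * (3 / 2 : ℝ) ^ (r + 1)) / (q : ℝ) ^ (r + 1)) ∧
      ∑' r : ℕ, (if r + 1 = 1 then A₁ else C₀ * (3 / 2 : ℝ) ^ (r + 1)) / (q : ℝ) ^ (r + 1) ≤
        A₁ / q + 9 * C₀ / (q : ℝ) ^ 2 := by
  have hq0 : (0 : ℝ) < q := by exact_mod_cast (show 0 < q by omega)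
  obtain ⟨hs, hle⟩ := tsum_geometric_tail_le hq
  set F : ℕ → ℝ := fun r =>
    (if r + 1 = 1 then A₁ else C₀ * (3 / 2 : ℝ) ^ (r + 1)) / (q : ℝ) ^ (r + 1) with hF
  -- the shifted sequence is the geometric tail
  have hshift : ∀ r : ℕ, F (r + 1) = C₀ * (3 / (2 * (q : ℝ))) ^ (r + 2) := by
    intro r
    simp only [hF, show r + 1 + 1 ≠ 1 by omega, if_false]
    rw [show r + 1 + 1 = r + 2 by ring, mul_div_assoc, ← div_pow, div_div]
  have hs1 : Summable (fun r : ℕ => F (r + 1)) := by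
    simp_rw [hshift]; exact hs.mul_left C₀
  have hsF : Summable F := (summable_nat_add_iff 1).mp hs1
  refine ⟨hsF, ?_⟩
  rw [hsF.tsum_eq_zero_add]
  have h0 : F 0 = A₁ / q := by simp [hF]
  rw [h0]
  simp_rw [hshift]
  rw [tsum_mul_left]
  have : C₀ * ∑' r : ℕ, (3 / (2 * (q : ℝ))) ^ (r + 2) ≤ C₀ * (9 / (q : ℝ) ^ 2) :=
    mul_le_mul_of_nonneg_left hle hC₀
  calc A₁ / ↑q + C₀ * ∑' r : ℕ, (3 / (2 * (q : ℝ))) ^ (r + 2) ≤ A₁ / q + C₀ * (9 / (q : ℝ) ^ 2) := by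
        linarith
    _ = A₁ / q + 9 * C₀ / (q : ℝ) ^ 2 := by ring

/-! ## The edge: local multiplicative majorant ⇒ `Inline16_varpi2WeightSum` -/

/-- Any real threshold on `𝓛 = log D` is met for all large `D`. [folklore] -/
private theorem exists_forall_le_ell_vw (M : ℝ) : ∃ D₀ : ℕ, ∀ D : ℕ, D₀ ≤ D → M ≤ ell D :=
  exists_forall_le_ell M

open scoped Classical in
/-- **`Inline16_varpi2WeightSum` from a local multiplicative majorant of `|ϖ₂ⱼ|τ₃`** (the summation
half of GAP row G-L4t5-1's input): if for all large `D` under (A), `j = 1,2` and all `n₁ ∈ 𝒩(𝔮)`,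
`n₁ < T`, `|ϖ₂ⱼ(n₁)|τ₃(n₁) ≤ K₀∏_{q^r∥n₁}a(q,r)` with `a(q,1) = 6 + C₀(q⁻¹ + α𝓛 log q)`,
`a(q,r) = C₀(3/2)^r` (`r ≥ 2`), then `Σ_{n₁∈𝒩(𝔮),n₁<T}|ϖ₂ⱼ(n₁)|τ₃(n₁)/n₁ ≤ K₀e^{24+21C₀}4⁶·𝓛⁶` for all
large `D` under (A). The pointwise hypothesis is where the local structure of `ϖ₂ⱼ` (App. A
pp. 105–106) enters; it is spelled inline (no new `Prop`). [cite: Zhang2022LandauSiegel, §16 (16.15) p.94] -/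
theorem inline16_varpi2WeightSum_of_localMajorant (c' : ℝ)
    (hloc : ∃ K₀ C₀ : ℝ, 0 ≤ K₀ ∧ 0 ≤ C₀ ∧ ForAllLarge fun D _ χ => AssumptionA D χ →
      ∀ j ∈ ({1, 2} : Finset ℕ), ∀ n₁ : ℕ, n₁ ∈ nset (frakq D) → (n₁ : ℝ) < bigT D →
        ‖varpi2 c' χ j n₁‖ * tau3R n₁ ≤ K₀ * ∏ q ∈ n₁.primeFactors,
          (if n₁.factorization q = 1 then 6 + C₀ * ((q : ℝ)⁻¹ + alpha D * ell D * Real.log q)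
            else C₀ * (3 / 2 : ℝ) ^ n₁.factorization q)) :
    Inline16_varpi2WeightSum c' := by
  obtain ⟨K₀, C₀, hK₀, hC₀, D₁, h₁⟩ := hloc
  obtain ⟨D₂, hD₂⟩ := exists_forall_le_ell_vw 1
  -- threshold making `C₀α𝓛(4𝓛 + log 4) ≤ C₀`: `α𝓛 = π𝓛⁻⁸`, so `𝓛 ≥ 7π` suffices
  obtain ⟨D₃, hD₃⟩ := exists_forall_le_ell_vw (7 * Real.pi)
  refine ⟨K₀ * Real.exp (4 * 6 + 21 * C₀) * 4 ^ 6, max D₁ (max D₂ (max D₃ 2)),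
    fun D _ χ hD hq hp hA j hj => ?_⟩
  have hD1 : D₁ ≤ D := le_trans (le_max_left _ _) hD
  have hℓ1 : 1 ≤ ell D := hD₂ D (le_trans (le_trans (le_max_left _ _) (le_max_right _ _)) hD)
  have hℓπ : 7 * Real.pi ≤ ell D :=
    hD₃ D (le_trans (le_trans (le_trans (le_max_left _ _) (le_max_right _ _)) (le_max_right _ _)) hD)
  have hD2 : 2 ≤ D := le_trans (le_trans (le_trans (le_max_right _ _) (le_max_right _ _))
    (le_max_right _ _)) hD
  have hℓ0 : 0 < ell D := by linarith
  have hloc := h₁ D χ hD1 hq hp hA j hj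
  -- the weights at this `D`
  set a : ℕ → ℕ → ℝ := fun q r =>
    if r = 1 then 6 + C₀ * ((q : ℝ)⁻¹ + alpha D * ell D * Real.log q) else C₀ * (3 / 2 : ℝ) ^ r
    with ha_def
  have hα0 : 0 < alpha D := Skeleton.alpha_pos_of_ell_pos hℓ0
  have ha0 : ∀ q r, 0 ≤ a q r := by
    intro q r
    simp only [ha_def]
    split_ifs
    · have : 0 ≤ C₀ * ((q : ℝ)⁻¹ + alpha D * ell D * Real.log q) :=
        mul_nonneg hC₀ (add_nonneg (inv_nonneg.mpr (Nat.cast_nonneg q))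
          (mul_nonneg (mul_nonneg hα0.le hℓ0.le) (Real.log_natCast_nonneg q)))
      linarith
    · positivity
  have hsum : ∀ q : ℕ, q.Prime → Summable fun r : ℕ => a q (r + 1) / (q : ℝ) ^ (r + 1) :=
    fun q hq' => (local_euler_sum_le hq'.two_le (A₁ := 6 + C₀ * ((q : ℝ)⁻¹ +
      alpha D * ell D * Real.log q)) hC₀).1
  -- the set of summation and its smoothness
  set A : Finset ℕ := (Finset.Ico 1 ⌈bigT D⌉₊).filter (fun n₁ => n₁ ∈ nset (frakq D)) with hA_def
  have hAsm : ∀ n ∈ A, n ∈ Nat.smoothNumbers (D ^ 4) := fun n hn =>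
    mem_nset_frakq_iff.mp (Finset.mem_filter.mp hn).2
  -- pointwise: `|ϖ₂ⱼ(n₁)|τ₃(n₁) ≤ K₀·M_a(n₁)` on `A`
  have hpt : ∀ n ∈ A, ‖varpi2 c' χ j n‖ * tau3R n / n ≤
      K₀ * ((∏ q ∈ n.primeFactors, a q (n.factorization q)) / n) := by
    intro n hn
    obtain ⟨hn1, hn2⟩ := Finset.mem_filter.mp hn
    have hnT : (n : ℝ) < bigT D := by
      have := (Finset.mem_Ico.mp hn1).2
      exact Nat.lt_ceil.mp this
    have h := hloc n hn2 hnT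
    rw [mul_div_assoc']
    exact div_le_div_of_nonneg_right (by simpa [ha_def] using h) (Nat.cast_nonneg n)
  -- the Euler product bound
  have hD4 : 2 ≤ D ^ 4 := le_trans hD2 (Nat.le_self_pow (by norm_num) D)
  have hE := sum_smooth_multMajorant_div_le_prod ha0 hsum hAsm
  -- local Euler sums: `≤ 6/q + g(q)`, `g(q) = 10C₀/q² + C₀α𝓛·log q/q`
  set g : ℕ → ℝ := fun q => 10 * C₀ / (q : ℝ) ^ 2 + C₀ * (alpha D * ell D) * (Real.log q / q)
    with hg_def
  have hloc_le : ∀ q ∈ (D ^ 4).primesBelow,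
      ∑' r : ℕ, a q (r + 1) / (q : ℝ) ^ (r + 1) ≤ ((6 : ℕ) : ℝ) / q + g q := by
    intro q hq'
    have hqp : q.Prime := (Nat.mem_primesBelow.mp hq').2
    have hq0 : (0 : ℝ) < q := by exact_mod_cast hqp.pos
    have h := (local_euler_sum_le hqp.two_le
      (A₁ := 6 + C₀ * ((q : ℝ)⁻¹ + alpha D * ell D * Real.log q)) hC₀).2
    have hrw : (fun r : ℕ => a q (r + 1) / (q : ℝ) ^ (r + 1)) = fun r : ℕ =>
        (if r + 1 = 1 then 6 + C₀ * ((q : ℝ)⁻¹ + alpha D * ell D * Real.log q)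
          else C₀ * (3 / 2 : ℝ) ^ (r + 1)) / (q : ℝ) ^ (r + 1) := by
      funext r; simp only [ha_def]
    rw [hrw]
    refine h.trans (le_of_eq ?_)
    rw [hg_def]
    push_cast
    field_simp
    ring
  have hloc0 : ∀ q ∈ (D ^ 4).primesBelow, 0 ≤ ∑' r : ℕ, a q (r + 1) / (q : ℝ) ^ (r + 1) :=
    fun q _ => tsum_nonneg fun r => div_nonneg (ha0 _ _) (pow_nonneg (Nat.cast_nonneg q) _)
  -- `Σ_{q<D⁴} g(q) ≤ 20C₀ + C₀α𝓛(log D⁴ + log 4) ≤ 21C₀`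
  have hlogD4 : Real.log ((D ^ 4 : ℕ) : ℝ) = 4 * ell D := by
    rw [Nat.cast_pow, Real.log_pow, ell]; norm_num
  have hlog4 : Real.log 4 ≤ 2 := by
    have hexp2 : (4 : ℝ) ≤ Real.exp 2 := by
      have h1 := Real.exp_one_gt_d9
      have h2 : Real.exp 2 = Real.exp 1 * Real.exp 1 := by rw [← Real.exp_add]; norm_num
      rw [h2]; nlinarith
    have : Real.log 4 ≤ Real.log (Real.exp 2) := Real.log_le_log (by norm_num) hexp2
    rwa [Real.log_exp] at this
  have hαℓ : alpha D * ell D * (Real.log ((D ^ 4 : ℕ) : ℝ) + Real.log 4) ≤ 1 := by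
    have h9 := Skeleton.alpha_mul_ell_pow_nine (D := D) hℓ0
    have hα : alpha D = Real.pi / ell D ^ 9 := by
      rw [eq_div_iff (pow_pos hℓ0 9).ne']; exact h9
    have hαℓ2 : alpha D * ell D * (6 * ell D) ≤ 6 * Real.pi / ell D := by
      rw [hα, div_mul_eq_mul_div, div_mul_eq_mul_div, div_le_div_iff₀ (pow_pos hℓ0 9) hℓ0]
      have : Real.pi * ell D * (6 * ell D) * ell D = 6 * Real.pi * ell D ^ 3 := by ring
      rw [this]
      have h39 : ell D ^ 3 ≤ ell D ^ 9 := pow_le_pow_right₀ hℓ1 (by norm_num)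
      nlinarith [Real.pi_pos]
    have h67 : 6 * Real.pi / ell D ≤ 1 := by
      rw [div_le_one hℓ0]; linarith
    rw [hlogD4]
    calc alpha D * ell D * (4 * ell D + Real.log 4) ≤ alpha D * ell D * (6 * ell D) := by
          refine mul_le_mul_of_nonneg_left (by linarith) (mul_nonneg hα0.le hℓ0.le)
      _ ≤ 1 := hαℓ2.trans h67
  have hG : ∑ q ∈ (D ^ 4).primesBelow, g q ≤ 21 * C₀ := by
    have hsq : ∑ q ∈ (D ^ 4).primesBelow, (1 : ℝ) / (q : ℝ) ^ 2 ≤ 2 := by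
      have hH := hasSum_zeta_two
      have hle : ∑ q ∈ (D ^ 4).primesBelow, (1 : ℝ) / (q : ℝ) ^ 2 ≤ Real.pi ^ 2 / 6 :=
        sum_le_hasSum _ (fun n _ => by positivity) hH
      have hπ : Real.pi ^ 2 / 6 ≤ 2 := by nlinarith [Real.pi_lt_d2, Real.pi_pos]
      exact hle.trans hπ
    have hlg := sum_primesBelow_log_div_le (D ^ 4)
    rw [hg_def, Finset.sum_add_distrib]
    have e1 : ∑ q ∈ (D ^ 4).primesBelow, 10 * C₀ / (q : ℝ) ^ 2 =
        10 * C₀ * ∑ q ∈ (D ^ 4).primesBelow, (1 : ℝ) / (q : ℝ) ^ 2 := by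
      rw [Finset.mul_sum]; exact Finset.sum_congr rfl fun q _ => by ring
    have e2 : ∑ q ∈ (D ^ 4).primesBelow, C₀ * (alpha D * ell D) * (Real.log q / q) =
        C₀ * (alpha D * ell D) * ∑ q ∈ (D ^ 4).primesBelow, Real.log q / q := by
      rw [Finset.mul_sum]
    rw [e1, e2]
    have hαℓ0 : 0 ≤ alpha D * ell D := mul_nonneg hα0.le hℓ0.le
    have t1 : 10 * C₀ * ∑ q ∈ (D ^ 4).primesBelow, (1 : ℝ) / (q : ℝ) ^ 2 ≤ 10 * C₀ * 2 :=
      mul_le_mul_of_nonneg_left hsq (by positivity)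
    have t2 : C₀ * (alpha D * ell D) * ∑ q ∈ (D ^ 4).primesBelow, Real.log q / q ≤ C₀ * 1 := by
      rw [mul_assoc]
      refine mul_le_mul_of_nonneg_left ?_ hC₀
      calc alpha D * ell D * ∑ q ∈ (D ^ 4).primesBelow, Real.log q / q
          ≤ alpha D * ell D * (Real.log ((D ^ 4 : ℕ) : ℝ) + Real.log 4) :=
            mul_le_mul_of_nonneg_left hlg hαℓ0
        _ ≤ 1 := hαℓ
    linarith
  have hprod := prod_primesBelow_one_add_le_of_sum_le hD4 6 hloc0 hloc_le hG
  -- assemble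
  have hsumK : ∑ n ∈ A, ‖varpi2 c' χ j n‖ * tau3R n / n ≤
      K₀ * ∑ n ∈ A, (∏ q ∈ n.primeFactors, a q (n.factorization q)) / n := by
    rw [Finset.mul_sum]; exact Finset.sum_le_sum hpt
  calc ∑ n ∈ A, ‖varpi2 c' χ j n‖ * tau3R n / n
      ≤ K₀ * ∑ n ∈ A, (∏ q ∈ n.primeFactors, a q (n.factorization q)) / n := hsumK
    _ ≤ K₀ * (Real.exp (4 * (6 : ℕ) + 21 * C₀) * Real.log ((D ^ 4 : ℕ) : ℝ) ^ 6) :=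
        mul_le_mul_of_nonneg_left (hE.trans hprod) hK₀
    _ = K₀ * Real.exp (4 * 6 + 21 * C₀) * 4 ^ 6 * ell D ^ 6 := by
        rw [hlogD4]; push_cast; ring

end Literature.NumberTheory.LFunctions.Zhang2022.Typed.Section16B

end
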